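import Literature.AlgebraicGeometry.HodgeTheory.TopHodgeClassesSpannedByPullbacksOfInputs
import Literature.AlgebraicGeometry.HodgeTheory.ChernCharacterTautologicalPullback
import Literature.AlgebraicGeometry.Motives.SmoothProjectiveNoetherLinEquiv
import Literature.AlgebraicGeometry.HodgeTheory.ChernCharacterTautologicalLinEquiv
import Literature.AlgebraicGeometry.HodgeTheory.TautologicalBundleSegre
import Literature.AlgebraicGeometry.Motives.EffectiveCartierSerreA
import Literature.AlgebraicGeometry.HodgeTheory.LefschetzOneOneEmbeddingCurrency
import HarnessLib

/-!
# The rational `(d,d)`-classes of a `(d+1)`-fold are spanned by pull-backs from `ℙ^{d+1}` (discharge of the named fact)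

Family `hodge`, layer `Literature/AlgebraicGeometry/HodgeTheory`. DISCHARGE of the named fact
`topHodgeClasses_spanned_by_pullbacks` (`HodgeTheory/TopHodgeClassesSpannedByPullbacksFact`): the five inputs of
`topHodgeClasses_spanned_by_pullbacks_of_inputs` (`HodgeTheory/TopHodgeClassesSpannedByPullbacksOfInputs`) are
theorems of the tree — (A) `HodgeModel.exists_chernCharacter_tautologicalBundle_pullback_eq_smul_map`
(`ChernCharacterTautologicalPullback`), (C) `HodgeModel.chernCharacter_tautologicalBundle_pullback_eq_smul_of_linEquiv`
(`ChernCharacterTautologicalLinEquiv`), (E1) `Motives.IsSmoothProjective.exists_isFinite_surjective_hyperplane_pullback_linEquiv`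
(`Motives/SmoothProjectiveNoetherLinEquiv`), (P1) `HodgeModel.chernCharacter_tautologicalBundle_segre` (`TautologicalBundleSegre`),
(G4) `lefschetzOneOne_tautological_of_serreA` (`LefschetzOneOneEmbeddingCurrency`) fed with
`Motives.CartierDivisor.effectiveCartier_linEquiv_hyperplanePullbacks` (`Motives/EffectiveCartierSerreA`). In print: hard Lefschetz
(Voisin I Thm. 6.25), the Lefschetz theorem on `(1,1)`-classes (Thm. 11.30) with GAGA, Serre's theorem A (Hartshorne II 5.17) and
projective Noether normalisation (Görtz–Wedhorn 13.89). Consequence recorded: Voisin II Lemma 9.18 for the complex orientations from the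
degree formula alone (`Voisin2003_cycleClass_div_eq_zero_complexOrientation_of_degreeFormula`).

## References

* [VoisinHodgeI2002] C. Voisin, Hodge Theory and Complex Algebraic Geometry I, CUP 2002, Thm. 6.25, Thm. 11.30.
* [VoisinHodgeII2003] C. Voisin, Hodge Theory and Complex Algebraic Geometry II, CUP 2003, Lemma 9.18.
* [Hartshorne1977] R. Hartshorne, Algebraic Geometry, GTM 52, II Thm. 5.17, II Thm. 7.1.
* [GortzWedhorn2020] U. Görtz, T. Wedhorn, Algebraic Geometry I, 2nd ed., Thm. 13.89.
-/

noncomputable section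

namespace Literature.AlgebraicGeometry.HodgeTheory

/-- **`topHodgeClasses_spanned_by_pullbacks` holds.** [cite: VoisinHodgeI2002, Thm. 6.25 and Thm. 11.30]
[cite: Hartshorne1977, II Thm. 5.17 and II Thm. 7.1] -/
theorem topHodgeClasses_spanned_by_pullbacks_holds : topHodgeClasses_spanned_by_pullbacks :=
  topHodgeClasses_spanned_by_pullbacks_of_inputs
    HodgeModel.exists_chernCharacter_tautologicalBundle_pullback_eq_smul_map
    HodgeModel.chernCharacter_tautologicalBundle_pullback_eq_smul_of_linEquiv
    Motives.IsSmoothProjective.exists_isFinite_surjective_hyperplane_pullback_linEquiv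
    HodgeModel.chernCharacter_tautologicalBundle_segre
    (lefschetzOneOne_tautological_of_serreA Motives.CartierDivisor.effectiveCartier_linEquiv_hyperplanePullbacks)

/-- **Voisin II Lemma 9.18 for the complex orientations, from Fulton's degree formula alone.**
[cite: VoisinHodgeII2003, Lemma 9.18] -/
theorem Voisin2003_cycleClass_div_eq_zero_complexOrientation_of_degreeFormula
    (hA : Fulton1998_degreeFormula_complexOrientation) : Voisin2003_cycleClass_div_eq_zero_complexOrientation :=
  Voisin2003_cycleClass_div_eq_zero_complexOrientation_of_degreeFormula_of_spanning hA
    topHodgeClasses_spanned_by_pullbacks_holds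

end Literature.AlgebraicGeometry.HodgeTheory

end
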